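import Summits.CriticalPhenomena.PercolationContinuityZ3.Theorems.PercNearOneGluingNoHeavyLowerTailQuantitativeS5CritComplete
import HarnessLib

/-!
# The explicit (S5) floor of row M2-R21 is COMPLETE: maximised over tie-breaking ranks it is positive exactly when the margin is

Support file (`--supports stmt-CriticalPhenomena-4575`), prover seat `prim-rate-mine-2` (lane prim-rate, constants-miner (c), BENCH rows
M2-R21 / M2-R22′ / M2-R24 / M2-R27; `run/shared/lean/prim/prim-rate/prim-rate-mine-2/PROOFS.md` §P27).  No definitions, no named facts, no sorries;
standard axioms.

Row M2-R21 (kernel `CSH.s5dMargin_ge_sum_rankGain_add_isolatedFloor_of_lt_one_of_compat`) gives, for EVERY compatible injective rank `r'`, the explicit floor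
  `FLOOR(r') := Σ_{a ∈ T} ( γ_a(r')·q_a + ∏_{e ∩ T_{<a}(r') ≠ ∅}(1 − w_e) · Cov_{w_{T_{<a}(r')}}(1{a ↔ b}, 1{o ↔ {a} ∪ T_{>a}(r') ∨ o ↔ v}) ) ≤ margin`,
and the margin does not depend on `r'` (`CSH.s5dMargin_nil_eq_of_compat`).  At a tie-unfavourable rank `FLOOR(r')` may vanish while the margin is positive
(`refutations/M2-R22-TIE.json`).  Here:
* `CSH.isolatedFloor_term_pos_of_exists_pivotal_of_compat` — the isolated Harris term of a relay `a` is POSITIVE under the pivotal criterion of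
  `CSH.s5dMargin_nil_pos_of_exists_pivotal_of_compat` (equality case of Harris, row M2-R17, in the world with `T_{<a}` isolated) — the quantitative
  content of that kernel theorem, exported;
* `CSH.s5dMargin_nil_pos_iff_exists_compat_rank_floor_pos` — **`0 < margin ⟺ ∃ compatible injective r', 0 < FLOOR(r')`** (connected non-degenerate
  support, `T ≠ ∅`, `o ≠ v` off `T`, `F = 1{b ∈ ·}`): the explicit floor family `{FLOOR(r')}` is COMPLETE — via the completeness of CRIT⁼
  (`CSH.s5dMargin_nil_pos_iff_critRankFree`) at the tie-first rank of the critical relay (`CSH.exists_compat_rank_tieFirst`).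
So `max_{r'} FLOOR(r')` is an explicit, computable lower bound of the (S5) margin with EXACTLY the margin's zero set `(M1) ∨ (M2)`
(`CSH.s5dMargin_nil_eq_zero_iff`), attained with equality on the single-gateway family (`CSH.s5dMargin_nil_eq_sum_rankGain_mul_avoidConst_of_gateway`).
[cite: KozmaNitzan2024, Conj. 4 (p. 32)] [cite: Harris1960, Lemma 4.1 (p. 16)] [cite: VandenbergHaggstromKahn2005, §2.1 (pp. 9–13)]
-/

noncomputable section

namespace Summit.CriticalPhenomena.PercolationContinuityZ3.Theorems

open MeasureTheory Set Literature.Probability.LatticeModels Literature.Probability.Percolation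
open scoped Classical

namespace CSH

variable {n : ℕ}

/-- **The isolated Harris term of a relay is positive under the pivotal criterion.**  Weights non-degenerate on their support `E`; `a ∈ T`; a pair
`e ∈ E` missing `T_{<a}(r)` that is pivotal, at configurations inside `E − pairs(T_{<a}(r))`, both for `{a ↔ b}` and for `{o ↔ {a} ∪ T_{>a}(r)} ∪ {o ↔ v}`.
Then `0 < ∏_{e ∩ T_{<a} ≠ ∅}(1 − w_e) · Cov_{w_{T_{<a}}}(1{b ∈ Ĉ_a}, 1_U)` (the `a`-summand of the M2-R21 floor beyond `γ_a q_a`): the product is positive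
as all weights are `< 1`, and the covariance is positive by the equality case of Harris (`QuantHarris.cov_pos_iff_exists_pivotal`, row M2-R17) for the
zeroed weights, which are non-degenerate exactly on `E − pairs(T_{<a}(r))`. [cite: Harris1960, Lemma 4.1 (p. 16)] [cite: KozmaNitzan2024, Conj. 4 (p. 32)] -/
theorem isolatedFloor_term_pos_of_exists_pivotal_of_compat (w : Sym2 (Fin n) → unitInterval) (E : Set (Sym2 (Fin n)))
    (hE0 : ∀ f, f ∉ E → (w f : ℝ) = 0) (hE1 : ∀ f ∈ E, 0 < (w f : ℝ) ∧ (w f : ℝ) < 1) (o v b : Fin n)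
    (T : Finset (Fin n)) (r : Fin n → ℕ) (a : Fin n)
    (hcrit : ∃ e ∈ E, (∀ y ∈ T.filter (fun b' => r b' < r a), y ∉ e) ∧
      (∃ η : Set (Sym2 (Fin n)), η ⊆ {f | f ∈ E ∧ ∀ y ∈ T.filter (fun b' => r b' < r a), y ∉ f} ∧
        insert e η ∈ (openConn a b : Set (BondConfig (Fin n))) ∧ η \ {e} ∉ (openConn a b : Set (BondConfig (Fin n)))) ∧
      (∃ η : Set (Sym2 (Fin n)), η ⊆ {f | f ∈ E ∧ ∀ y ∈ T.filter (fun b' => r b' < r a), y ∉ f} ∧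
        insert e η ∈ (((⋃ t ∈ (insert a (T.filter (fun b' => r a < r b') ∪ ([] : List (Fin n)).toFinset)), openConn o t) ∪ openConn o v :
          Set (BondConfig (Fin n)))) ∧
        η \ {e} ∉ (((⋃ t ∈ (insert a (T.filter (fun b' => r a < r b') ∪ ([] : List (Fin n)).toFinset)), openConn o t) ∪ openConn o v :
          Set (BondConfig (Fin n)))))) :
    0 < (∏ e ∈ Finset.univ.filter (fun e : Sym2 (Fin n) => ∃ y ∈ (↑(T.filter (fun b' => r b' < r a)) : Set (Fin n)), y ∈ e), (1 - (w e : ℝ))) *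
      ((∫ η in ((⋃ t ∈ (insert a (T.filter (fun b' => r a < r b') ∪ ([] : List (Fin n)).toFinset)), openConn o t) ∪ openConn o v),
          (fun S : Set (Fin n) => if b ∈ S then (1 : ℝ) else 0) {c | c = a ∨ ∃ e ∈ openEdgeCluster η a, c ∈ e}
          ∂(prodBernoulli fun e => if (∃ y ∈ (↑(T.filter (fun b' => r b' < r a)) : Set (Fin n)), y ∈ e) then (0 : unitInterval) else w e)) -
        (prodBernoulli fun e => if (∃ y ∈ (↑(T.filter (fun b' => r b' < r a)) : Set (Fin n)), y ∈ e) then (0 : unitInterval) else w e).real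
            ((⋃ t ∈ (insert a (T.filter (fun b' => r a < r b') ∪ ([] : List (Fin n)).toFinset)), openConn o t) ∪ openConn o v) *
          (∫ η, (fun S : Set (Fin n) => if b ∈ S then (1 : ℝ) else 0) {c | c = a ∨ ∃ e ∈ openEdgeCluster η a, c ∈ e}
            ∂(prodBernoulli fun e => if (∃ y ∈ (↑(T.filter (fun b' => r b' < r a)) : Set (Fin n)), y ∈ e) then (0 : unitInterval) else w e))) := by
  set F : Set (Fin n) → ℝ := fun S => if b ∈ S then (1 : ℝ) else 0 with hFdef
  set Y : Set (Fin n) := (↑(T.filter (fun b' => r b' < r a)) : Set (Fin n)) with hY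
  set U : Set (BondConfig (Fin n)) :=
    (⋃ t ∈ (insert a (T.filter (fun b' => r a < r b') ∪ ([] : List (Fin n)).toFinset)), openConn o t) ∪ openConn o v with hU
  set qY : Sym2 (Fin n) → unitInterval := fun e => if (∃ y ∈ Y, y ∈ e) then (0 : unitInterval) else w e with hqY
  set EY : Set (Sym2 (Fin n)) := {f | f ∈ E ∧ ∀ y ∈ T.filter (fun b' => r b' < r a), y ∉ f} with hEY
  have hmeas : ∀ S : Set (BondConfig (Fin n)), MeasurableSet S := fun _ => MeasurableSet.of_discrete
  have hw1r : ∀ e, (w e : ℝ) < 1 := by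
    intro e
    by_cases he : e ∈ E
    · exact (hE1 e he).2
    · rw [hE0 e he]; norm_num
  -- the isolated Harris term of `a` is a covariance of two up-sets under `prodBernoulli qY`
  have hFind : (fun η : BondConfig (Fin n) => F {c | c = a ∨ ∃ e ∈ openEdgeCluster η a, c ∈ e}) =
      (openConn a b : Set (BondConfig (Fin n))).indicator fun _ => (1 : ℝ) := by
    funext η
    have hiff : η ∈ (openConn a b : Set (BondConfig (Fin n))) ↔ (b = a ∨ ∃ e ∈ openEdgeCluster η a, b ∈ e) :=
      reachable_iff_exists_mem_openEdgeCluster η a b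
    simp only [hFdef, mem_setOf_eq]
    by_cases hη : (b = a ∨ ∃ e ∈ openEdgeCluster η a, b ∈ e)
    · rw [if_pos hη, Set.indicator_of_mem (hiff.2 hη)]
    · rw [if_neg hη, Set.indicator_of_notMem (fun h' => hη (hiff.1 h'))]
  have hUup : ∀ ω ω' : BondConfig (Fin n), ω ⊆ ω' → ω ∈ U → ω' ∈ U := by
    rintro ω ω' hle (h | h)
    · obtain ⟨t, ht, h⟩ := Set.mem_iUnion₂.1 h
      exact Or.inl (Set.mem_iUnion₂.2 ⟨t, ht, SimpleGraph.Reachable.mono (BHK2006.openGraph_le hle) h⟩)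
    · exact Or.inr (SimpleGraph.Reachable.mono (BHK2006.openGraph_le hle) h)
  have hBup : ∀ ω ω' : BondConfig (Fin n), ω ⊆ ω' → ω ∈ (openConn a b : Set (BondConfig (Fin n))) →
      ω' ∈ (openConn a b : Set (BondConfig (Fin n))) :=
    fun _ _ hle h => SimpleGraph.Reachable.mono (BHK2006.openGraph_le hle) h
  have hcov : (∫ η in U, F {c | c = a ∨ ∃ e ∈ openEdgeCluster η a, c ∈ e} ∂(prodBernoulli qY)) -
      (prodBernoulli qY).real U * (∫ η, F {c | c = a ∨ ∃ e ∈ openEdgeCluster η a, c ∈ e} ∂(prodBernoulli qY)) =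
      (prodBernoulli qY).real (U ∩ openConn a b) - (prodBernoulli qY).real U * (prodBernoulli qY).real (openConn a b) := by
    rw [hFind, integral_indicator (hmeas _), integral_indicator (hmeas _), Measure.restrict_restrict (hmeas _)]
    simp only [integral_const, smul_eq_mul, mul_one, measureReal_restrict_apply_univ]
    rw [Set.inter_comm]
  -- the zeroed weights are non-degenerate exactly on `EY`
  have hq0 : ∀ e, e ∉ EY → ((qY e : unitInterval) : ℝ) = 0 := by
    intro e he
    simp only [hqY]
    by_cases hc : ∃ y ∈ Y, y ∈ e
    · rw [if_pos hc]; rfl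
    · rw [if_neg hc]
      apply hE0 e
      intro heE
      apply he
      refine ⟨heE, fun y hy hye => hc ⟨y, ?_, hye⟩⟩
      rw [hY, Finset.mem_coe]; exact hy
  have hq1 : ∀ e ∈ EY, 0 < ((qY e : unitInterval) : ℝ) ∧ ((qY e : unitInterval) : ℝ) < 1 := by
    intro e he
    have hc : ¬ ∃ y ∈ Y, y ∈ e := by
      rintro ⟨y, hy, hye⟩
      rw [hY, Finset.mem_coe] at hy
      exact he.2 y hy hye
    simp only [hqY]
    rw [if_neg hc]
    exact hE1 e he.1
  have hcovpos : 0 < (prodBernoulli qY).real (U ∩ openConn a b) -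
      (prodBernoulli qY).real U * (prodBernoulli qY).real (openConn a b) := by
    obtain ⟨e, heE, heY, hpB, hpU⟩ := hcrit
    have h := (QuantHarris.cov_pos_iff_exists_pivotal qY EY hq0 hq1 U (openConn a b) hUup hBup).2 ⟨e, ⟨heE, heY⟩, hpU, hpB⟩
    linarith
  have hprodpos : 0 < ∏ e ∈ Finset.univ.filter (fun e : Sym2 (Fin n) => ∃ y ∈ Y, y ∈ e), (1 - (w e : ℝ)) :=
    Finset.prod_pos fun e _ => by linarith [hw1r e]
  rw [hcov]
  exact mul_pos hprodpos hcovpos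

/-- **The explicit floor of row M2-R21 is COMPLETE over tie-breaking ranks**: with weights non-degenerate on a connected support `E`, `T ≠ ∅`,
`r` injective compatible with the means of `1{b ∈ ·}`, `o ≠ v` off `T`,
`0 < s5dMargin w T r [] o v 1{b ∈ ·}  ⟺  ∃ r' injective m-compatible on T, 0 < FLOOR(r')`,
`FLOOR(r') = Σ_{a∈T} (γ_a(r')·q_a + ∏_{e ∩ T_{<a}(r') ≠ ∅}(1 − w_e)·Cov_{w_{T_{<a}(r')}}(1{a ↔ b}, 1{o ↔ {a} ∪ T_{>a}(r') ∨ o ↔ v}))` being the left side of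
`CSH.s5dMargin_ge_sum_rankGain_add_isolatedFloor_of_lt_one_of_compat`.  (⟸: floor `≤` margin at `r'` and rank-freeness of the margin; ⟹: CRIT⁼
(`CSH.s5dMargin_nil_pos_iff_critRankFree`) — the `γq` disjunct is a summand at `r' = r`, the path disjunct makes the isolated term of the critical relay
positive at its tie-first rank.)  BENCH row M2-R27. [cite: KozmaNitzan2024, Conj. 4 (p. 32)] [cite: Harris1960, Lemma 4.1 (p. 16)] -/
theorem s5dMargin_nil_pos_iff_exists_compat_rank_floor_pos (w : Sym2 (Fin n) → unitInterval) (E : Set (Sym2 (Fin n)))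
    (hE0 : ∀ f, f ∉ E → (w f : ℝ) = 0) (hE1 : ∀ f ∈ E, 0 < (w f : ℝ) ∧ (w f : ℝ) < 1)
    (hconn : (openGraph E).Preconnected) (o v b : Fin n) (hov : o ≠ v)
    (T : Finset (Fin n)) (hT : T.Nonempty) (r : Fin n → ℕ) (hr : Set.InjOn r ↑T)
    (hcompat : ∀ a ∈ T, ∀ a' ∈ T, r a < r a' →
      ∫ ω, (fun S : Set (Fin n) => if b ∈ S then (1 : ℝ) else 0) (openCluster ω a) ∂(prodBernoulli w) ≤
        ∫ ω, (fun S : Set (Fin n) => if b ∈ S then (1 : ℝ) else 0) (openCluster ω a') ∂(prodBernoulli w))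
    (hoT : o ∉ T) (hvT : v ∉ T) :
    0 < s5dMargin w T r [] o v (fun S : Set (Fin n) => if b ∈ S then (1 : ℝ) else 0) ↔
      ∃ r' : Fin n → ℕ, Set.InjOn r' ↑T ∧
        (∀ a ∈ T, ∀ a' ∈ T, r' a < r' a' →
          ∫ ω, (fun S : Set (Fin n) => if b ∈ S then (1 : ℝ) else 0) (openCluster ω a) ∂(prodBernoulli w) ≤
            ∫ ω, (fun S : Set (Fin n) => if b ∈ S then (1 : ℝ) else 0) (openCluster ω a') ∂(prodBernoulli w)) ∧
        0 < ∑ a ∈ T, (rankGain w T r' (fun S : Set (Fin n) => if b ∈ S then (1 : ℝ) else 0) a *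
              avoidConst w a ((↑(T.erase a) : Set (Fin n)) ∪ ({d | d ∈ ([] : List (Fin n))} ∪ {v})) o +
          (∏ e ∈ Finset.univ.filter (fun e : Sym2 (Fin n) => ∃ y ∈ (↑(T.filter (fun b' => r' b' < r' a)) : Set (Fin n)), y ∈ e),
              (1 - (w e : ℝ))) *
            ((∫ η in ((⋃ t ∈ (insert a (T.filter (fun b' => r' a < r' b') ∪ ([] : List (Fin n)).toFinset)), openConn o t) ∪ openConn o v),
                (fun S : Set (Fin n) => if b ∈ S then (1 : ℝ) else 0) {c | c = a ∨ ∃ e ∈ openEdgeCluster η a, c ∈ e}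
                ∂(prodBernoulli fun e =>
                  if (∃ y ∈ (↑(T.filter (fun b' => r' b' < r' a)) : Set (Fin n)), y ∈ e) then (0 : unitInterval) else w e)) -
              (prodBernoulli fun e =>
                  if (∃ y ∈ (↑(T.filter (fun b' => r' b' < r' a)) : Set (Fin n)), y ∈ e) then (0 : unitInterval) else w e).real
                  ((⋃ t ∈ (insert a (T.filter (fun b' => r' a < r' b') ∪ ([] : List (Fin n)).toFinset)), openConn o t) ∪ openConn o v) *
                (∫ η, (fun S : Set (Fin n) => if b ∈ S then (1 : ℝ) else 0) {c | c = a ∨ ∃ e ∈ openEdgeCluster η a, c ∈ e}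
                  ∂(prodBernoulli fun e =>
                    if (∃ y ∈ (↑(T.filter (fun b' => r' b' < r' a)) : Set (Fin n)), y ∈ e) then (0 : unitInterval) else w e)))) := by
  set μ := prodBernoulli w with hμ
  set Fb : Set (Fin n) → ℝ := fun S => if b ∈ S then (1 : ℝ) else 0 with hFb
  set m : Fin n → ℝ := fun c => ∫ ω, Fb (openCluster ω c) ∂μ with hmdef
  have hw1 : ∀ e, w e < 1 := fun e => by
    have h : (w e : ℝ) < 1 := by
      by_cases he : e ∈ E
      · exact (hE1 e he).2
      · rw [hE0 e he]; norm_num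
    exact Subtype.coe_lt_coe.1 (by simpa using h)
  have hFmono : ∀ S S' : Set (Fin n), S ⊆ S' → Fb S ≤ Fb S' := by
    intro S S' hSS'
    simp only [hFb]
    by_cases hS : b ∈ S
    · rw [if_pos hS, if_pos (hSS' hS)]
    · rw [if_neg hS]; split_ifs <;> norm_num
  have hF0 : ∀ S : Set (Fin n), 0 ≤ Fb S := fun S => by
    simp only [hFb]; split_ifs <;> norm_num
  constructor
  · intro hpos
    obtain ⟨a, haT, hcrit⟩ :=
      (s5dMargin_nil_pos_iff_critRankFree w E hE0 hE1 hconn o v b hov T hT r hr hcompat hoT hvT).1 hpos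
    rcases hcrit with ⟨hγ, hq⟩ | hpath
    · -- the `γ q` summand at the given rank
      refine ⟨r, hr, hcompat, ?_⟩
      have hnn := fun a' (ha' : a' ∈ T) => isolatedFloor_term_nonneg w o v T r Fb hFmono hF0 hcompat a' ha'
      have hsingle := Finset.single_le_sum (fun a' ha' => add_nonneg (hnn a' ha').1 (hnn a' ha').2) haT
      have hterm : 0 < rankGain w T r Fb a * avoidConst w a ((↑(T.erase a) : Set (Fin n)) ∪ ({d | d ∈ ([] : List (Fin n))} ∪ {v})) o :=
        mul_pos hγ hq
      linarith [(hnn a haT).2]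
    · -- the isolated term of `a` at its tie-first rank
      obtain ⟨r', hr', hcompat', htie⟩ := exists_compat_rank_tieFirst T r m hr hcompat a
      refine ⟨r', hr', hcompat', ?_⟩
      set Em : Set (Sym2 (Fin n)) := {f | f ∈ E ∧ ∀ y ∈ T, m y < m a → y ∉ f} with hEm
      set Er : Set (Sym2 (Fin n)) := {f | f ∈ E ∧ ∀ y ∈ T.filter (fun b' => r' b' < r' a), y ∉ f} with hEr
      have hEmEr : Em ⊆ Er := fun f hf =>
        ⟨hf.1, fun y hy => hf.2 y (Finset.mem_filter.1 hy).1 ((htie y (Finset.mem_filter.1 hy).1).1 (Finset.mem_filter.1 hy).2)⟩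
      set Sm : Finset (Fin n) := T.filter (fun t => m a ≤ m t) with hSm
      set Sr : Finset (Fin n) := insert a (T.filter (fun b' => r' a < r' b') ∪ ([] : List (Fin n)).toFinset) with hSr
      have hSmSr : ∀ z, z ∈ Sm → z ∈ Sr := by
        intro z hz
        obtain ⟨hzT, hmz⟩ := Finset.mem_filter.1 hz
        rw [hSr, Finset.mem_insert, Finset.mem_union]
        by_cases hza : z = a
        · exact Or.inl hza
        · refine Or.inr (Or.inl (Finset.mem_filter.2 ⟨hzT, ?_⟩))
          have h1 : ¬ r' z < r' a := fun h => (not_lt.2 hmz) ((htie z hzT).1 h)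
          rcases lt_trichotomy (r' z) (r' a) with h | h | h
          · exact absurd h h1
          · exact absurd (hr' hzT haT h) hza
          · exact h
      have hSrSm : ∀ y, y ∈ Sr → y ∈ Sm := by
        intro y hy
        rw [hSr, Finset.mem_insert, Finset.mem_union] at hy
        rcases hy with hya | hy | hy
        · rw [hya]; exact Finset.mem_filter.2 ⟨haT, le_rfl⟩
        · obtain ⟨hyT, hlt⟩ := Finset.mem_filter.1 hy
          exact Finset.mem_filter.2 ⟨hyT, hcompat' a haT y hyT hlt⟩
        · simp at hy
      have hedge : ∀ {x y : Fin n} (p : (openGraph Em).Walk x y), ∀ f ∈ p.edges, f ∈ (openGraph Er).edgeSet := by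
        intro x y p f hf
        rw [openGraph, SimpleGraph.edgeSet_fromEdgeSet]
        exact ⟨hEmEr (QuantBHK.mem_and_not_isDiag_of_mem_edges p hf).1, (QuantBHK.mem_and_not_isDiag_of_mem_edges p hf).2⟩
      obtain ⟨e, he, ⟨p, hp, hep⟩, z, hz, q, hq, heq, hsupp⟩ := hpath
      have hz' : z ∈ Sr ∨ z = v := by
        rcases hz with hz | hz
        · exact Or.inl (hSmSr z hz)
        · exact Or.inr hz
      have hsupp' : ∀ y ∈ (q.transfer (openGraph Er) (hedge q)).support, (y ∈ Sr ∨ y = v) → y = z := by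
        intro y hy hyS
        rw [SimpleGraph.Walk.support_transfer] at hy
        refine hsupp y hy ?_
        rcases hyS with hyS | hyS
        · exact Or.inl (hSrSm y hyS)
        · exact Or.inr hyS
      have hcrit' : ∃ e ∈ E, (∀ y ∈ T.filter (fun b' => r' b' < r' a), y ∉ e) ∧
          (∃ η : Set (Sym2 (Fin n)), η ⊆ Er ∧
            insert e η ∈ (openConn a b : Set (BondConfig (Fin n))) ∧ η \ {e} ∉ (openConn a b : Set (BondConfig (Fin n)))) ∧
          (∃ η : Set (Sym2 (Fin n)), η ⊆ Er ∧
            insert e η ∈ (((⋃ t ∈ Sr, openConn o t) ∪ openConn o v : Set (BondConfig (Fin n)))) ∧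
            η \ {e} ∉ (((⋃ t ∈ Sr, openConn o t) ∪ openConn o v : Set (BondConfig (Fin n))))) := by
        refine ⟨e, (hEmEr he).1, (hEmEr he).2, ?_, ?_⟩
        · exact (QuantBHK.pivotal_openConn_iff_exists_path _ e (hEmEr he) a b).2
            ⟨p.transfer (openGraph Er) (hedge p), hp.transfer _, by rw [SimpleGraph.Walk.edges_transfer]; exact hep⟩
        · exact pivotal_openConn_biUnion_of_path _ e o v _ z (q.transfer (openGraph Er) (hedge q)) (hq.transfer _)
            (by rw [SimpleGraph.Walk.edges_transfer]; exact heq) hsupp' hz'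
      have hiso := isolatedFloor_term_pos_of_exists_pivotal_of_compat w E hE0 hE1 o v b T r' a hcrit'
      have hnn := fun a' (ha' : a' ∈ T) => isolatedFloor_term_nonneg w o v T r' Fb hFmono hF0 hcompat' a' ha'
      have hsingle := Finset.single_le_sum (fun a' ha' => add_nonneg (hnn a' ha').1 (hnn a' ha').2) haT
      linarith [(hnn a haT).1]
  · rintro ⟨r', hr', hcompat', hfloor⟩
    have hle := s5dMargin_ge_sum_rankGain_add_isolatedFloor_of_lt_one_of_compat w hw1 o v hov T r' Fb hFmono hF0 hr' hcompat' hoT hvT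
    rw [s5dMargin_nil_eq_of_compat w T r r' o v Fb hr hr' hcompat hcompat']
    exact lt_of_lt_of_le hfloor hle

end CSH

end Summit.CriticalPhenomena.PercolationContinuityZ3.Theorems
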